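import Summits.QuantumFields.GaugeBoot.Certificates.SparseReducedWindow
import Summits.QuantumFields.GaugeBoot.Certificates.KZL2rpD4b3UpDA
import Summits.QuantumFields.GaugeBoot.Certificates.KZL2rpD4b3UpDB
import Summits.QuantumFields.GaugeBoot.Certificates.KZL2rpD4b3UpDC
import HarnessLib

/-!
# Kernel replay of the certsdp certificate `kzL2_D4_b3_max_rp_G2` — part G: factor-row assembly and objective (gb_lean_emit_win 0.9)

HONEST FRAMING (cell `pub-gaugeboot`): certified bounds on lattice expectations at stated coupling,
gauge group, dimension and torus size; NOT a mass gap, NOT a continuum limit, NOT a string tension;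
NOT Yang–Mills-summit-bearing (barriers `FixedCouplingUltralocality`, `PerturbativeInvisibility`).

Certificate sha256 `75d6be66e937515f61214f31e0bdceb53b1f2ecaef43eb129c4429045c66bc76` (problem `kzL2_D4_b3_max_rp_G2`, sha256 `50365c848079d8b09611da0d5032e58003e5859ae8a6c5bc68ad526f77c2d300`): `GB` = all factor rows (data parts
`Certificates/KZL2rpD4b3UpD….lean` concatenated), the INTEGER objective row `cZ`, the certified bound `lowerQ`, and the kernel check
`gb_len` (factor rows fit the padded dimension 48). Windows: `Certificates/KZL2rpD4b3UpA….lean`; assembly + theorems: `Certificates/KZL2rpD4b3Up.lean`.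
Data/plumbing only; nothing is claimed about lattice gauge theory in this file.
-/

namespace Summit.QuantumFields.GaugeBoot.Certificates.KZL2rpD4b3Up

noncomputable section

open Summit.QuantumFields.GaugeBoot.Certificates.Sparse

/-- All factor rows (concatenation of the data parts' block lists). -/
def GB : List (List (List ℤ)) := GBa ++ GBb ++ GBc

/-- Objective as a sparse INTEGER row: (-1)·y_1. -/
def cZ : List (ℕ × ℤ) := [(1, Int.negSucc 0)]

/-- The certified lower bound on the objective (exact): `-5642023899206515894449398271989646149/7476907476290151785083914714076938240` (≈ -0.7545932482243). -/
def lowerQ : ℚ := -5642023899206515894449398271989646149/7476907476290151785083914714076938240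

set_option maxHeartbeats 0 in
/-- Kernel check: every factor row of every block has length `≤ 48`. -/
theorem gb_len : lenCheckAll KZL2rpD4b3Up.GB 48 70 = true := by
  decide +kernel

end

end Summit.QuantumFields.GaugeBoot.Certificates.KZL2rpD4b3Up
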